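import Summits.QuantumFields.BalabanUV.T4Continuum.Support.ShellMeasureDecayRowsLevelOpCellsSlot

/-!
# `T4Continuum.ShellMeasureDecayRowsLevelOpTwoLevel` — ROW S116 = J1 (b) of the NE7c (α)-JUNCTION PROGRAMME: Beta's COVARIANT
# multiscale decay END `MultiscaleDecay.decay_levelOp_cov` FIRED BY NAME on the two-level SLOT family of ROW S117
# (`ShellMeasureSlotCubeFamily`, leaf-06-g10), the (3.35)-gauge datum supplied at the FLAT point, and a POSITIVE-rate numeric
# instance of the END's smallness at `d = 4`

(cell `pub-balaban`, sub-cell `t4`, NE7c (node U5b); NE7c ROUND-2 crew, unit `b2b-balaban-t4-ne7c-formalise-leaf-05` gen 12; owner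
RULING R-ne7cp1-g37-7 (journal l.23530): the (α) reading of record = `HOME/t4/…leaf-05/g12/ALPHA-IN-TREE-MAP.md`; owner table
`t4/b2b-balaban-t4-ne7c-p1/LEAVES-NE7c-P1.md` v3.9.17 ROW S116 «(J1) the normalisation dictionary … + one kernel example firing
`MultiscaleDecay.decay_levelOp_cov` on a two-level cube family shaped like a NE7c slot»; companion READING memo
`HOME/t4/…leaf-05/g12/J1-NORMALISATION-DICTIONARY.md` v1.1 ((D1) `levelOp = η²·Δ′_a(U)`, (D5) the prefactor `n(p)n(q)`, (D6) (3.35) =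
`hgauge`'s shape).  ESTIMATE LANE: imports `ShellMeasureDecayRowsLevelOpCellsSlot` (leaf-02-g13's J3 slot witness, over ROW S117 `ShellMeasureSlotCubeFamily` and
`Beta/MultiscaleDecay`) ONLY — v1 (p243626) bounced `dedup.landed` on the numeric lemma `mu0_pos_d4`, landed first there (same bytes,
credited); v2 REUSES it BY NAME; touches NO
host, NO link of the v5∕v6 chains; census COUNT unchanged; [folklore]; 0 `def`, 0 `def … : Prop`, 0 sorry, 0 citation tags.)

HONEST FRAMING.  Finite four-torus programme, rung (B)+1 only — NOT infinite volume, NOT a mass gap, NOT the Clay problem, NOT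
summit progress.  NE7c (`T4IndicatorShell.ShellWeightBound`) is NOT PRINTED in [Balaban 1983–89] and NOT PROVED; «NE7c ⇐ the named
binders» (trigger c3).  THIS FILE asserts nothing of Bałaban's: it is a JOINT-INHABITATION certificate (crew rule G-1) for the
hypothesis list of the row-D4 MODEL END `Beta.MultiscaleDecay.decay_levelOp_cov` on the DESIGNED slot family of S117 — the five
geometric terms `cells_disjoint cells_cover meanProfile_supp scale_lo scale_hi` BY NAME (leaf-06-g10), the orthogonality clauses for
identity transports, and the (3.35)-shaped gauge datum `(g, hg, ε, hε, hgauge, hloss)` at the FLAT point (identity cube gauges, `ε = 0`,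
`θ = 0`, by `MultiscaleCoerciveTorus.defect_flat`) — leaving displayed only the bond-weight sizes, the level coefficients' range and
the END's pure-number smallness `hμ`, whose `d = 4`, `κ = 10⁻³ > 0` instance is the landed `…CellsSlot.mu0_pos_d4` (S117's own `example` takes `κ = 0`).
The non-flat gauge datum from in-cell plaquette smallness is leaf-01-g12's J4 (OFFER O-ne7cleaf01g12-1), not here; Bałaban's
operators (node O), the sup∕gradient members ((D9): `hreg` + a gradient datum) and a junction into the ONE CALL are NOT here.
HONEST DEPENDENCY (cell): continuum YM on T⁴ ⇐ BetaPertH ∧ nine spine estimates (0/9 proved); BetaPertH ⇐ (D1) ∧ (D4) ∧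
CAP+tail; G-an2-4 gates asym, D1 and NE2/3/4.
-/

noncomputable section

open Finset Function
open Summit.QuantumFields.BalabanUV.Beta
open Summit.QuantumFields.BalabanUV.Beta.BoxPoincare (Box)
open Summit.QuantumFields.BalabanUV.Beta.CovariantBoxPoincare (hol succ)
open Summit.QuantumFields.BalabanUV.Beta.MultiscaleCoerciveTorus
open Summit.QuantumFields.BalabanUV.Beta.MultiscaleDecayBudget (siteScale)
open Summit.QuantumFields.BalabanUV.Beta.MultiscaleDistance (sdist)
open Summit.QuantumFields.BalabanUV.Beta.MultiscaleDecay (decay_levelOp_cov)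
open Summit.QuantumFields.BalabanUV.T4Continuum.ShellMeasureSlotCubeFamily
open Literature.MathematicalPhysics.QuantumFieldTheory.Balaban1983to89
open Literature.MathematicalPhysics.QuantumFieldTheory.Balaban1983to89.B9Thm37GluePU (bsrc btgt)
open Literature.MathematicalPhysics.QuantumFieldTheory.Balaban1983to89.B9Thm37GlueTorusCov (tblk torusComb)
open Literature.MathematicalPhysics.QuantumFieldTheory.Balaban1983to89.B9Thm37GlueTorusCovLevels (levelOp)
open B5TorusCover (UT Ctr ctrU nC)

namespace Summit.QuantumFields.BalabanUV.T4Continuum.ShellMeasureDecayRowsLevelOpTwoLevel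

variable {d : ℕ} [NeZero d] {N : Fin d → ℕ} [∀ i, NeZero (N i)] {Cp : Type} [Fintype Cp] [DecidableEq Cp]
variable {s L : ℕ} {Λ : Finset (Ctr N (L * s))} (hs : 1 ≤ s) (hL : 1 ≤ L) (hdiv : ∀ i, L * s ∣ N i)

/-- **`MultiscaleDecay.decay_levelOp_cov` ON THE TWO-LEVEL SLOT FAMILY OF S117, GAUGE DATUM AT THE FLAT POINT.**  Torus `UT N`, fine
side `s`, ratio `L`, coarse blocks `Λ` refined (S117's `Cell s L Λ`, `lvl`, `zc`, `meanProfile`, `treeWeight`); identity bond matrices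
`Rm ≡ 1` (so the covariant END's transports `(torusComb …).tr 1` and its identity cube gauges have holonomy defect `ε = 0`, loss
`θ = 0` — `MultiscaleCoerciveTorus.defect_flat`); bond weights `0 < c_min ≤ |c_b| ≤ c_max`, level coefficients `a_min ≤ α_l ≤ a_max`
(`0 ≤ a_min`), `κ ∈ [0,1]` with `μ₀ := (1 − 0)·min(c_min²∕(4d), a_min∕4) − 2d·c_max²κ² − a_max(e^{2dκ} − 1) > 0`.  Then the model
operator is a unit and `|levelOp⁻¹(p,q)| ≤ e^{−κ·d_n(p,q)}·n(p)n(q)∕μ₀`, `n = s` on the slot and `L·s` off it (S117 `siteScale_eq`) —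
the (D5) line of the J1 dictionary: prefactors `{s², L s², L²s²} = {1, L, L²}·η⁻²`.  Beta's END BY NAME; every geometric and gauge
binder supplied. [folklore] -/
theorem decay_levelOp_cov_slot_flatGauge
    {α : Bool → ℝ} {amin amax : ℝ} (hamin : 0 ≤ amin) (hα_lo : ∀ l, amin ≤ α l) (hα_hi : ∀ l, α l ≤ amax)
    (c : UT N × Fin d → ℝ) {cmin cmax : ℝ} (hcmin : 0 < cmin) (hc_lo : ∀ b, cmin ≤ |c b|) (hc_hi : ∀ b, |c b| ≤ cmax)
    {κ : ℝ} (hκ0 : 0 ≤ κ) (hκ1 : κ ≤ 1)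
    (hμ : 0 < (1 - (0 : ℝ)) * min (cmin ^ 2 / (4 * d)) (amin / 4) - 2 * d * cmax ^ 2 * κ ^ 2 -
      amax * (Real.exp (2 * d * κ) - 1))
    (p q : UT N × Cp) :
    IsUnit (levelOp bsrc btgt c (fun _ => (oneM : Cp → Cp → ℝ))
        (fun l x => ctrU N (side s L l) (tblk (side_pos hs hL l) (side_dvd hdiv l) x))
        (fun l x => meanProfile hs hL hdiv Λ l (ctrU N (side s L l) (tblk (side_pos hs hL l) (side_dvd hdiv l) x)))
        (fun l x => (torusComb (side_pos hs hL l) (side_dvd hdiv l)).tr (fun _ => (oneM : Cp → Cp → ℝ)) x)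
        (treeWeight d s L α)) ∧
      |Ring.inverse (levelOp bsrc btgt c (fun _ => (oneM : Cp → Cp → ℝ))
          (fun l x => ctrU N (side s L l) (tblk (side_pos hs hL l) (side_dvd hdiv l) x))
          (fun l x => meanProfile hs hL hdiv Λ l (ctrU N (side s L l) (tblk (side_pos hs hL l) (side_dvd hdiv l) x)))
          (fun l x => (torusComb (side_pos hs hL l) (side_dvd hdiv l)).tr (fun _ => (oneM : Cp → Cp → ℝ)) x)
          (treeWeight d s L α)) (Pi.single q 1) p| ≤
        Real.exp (-(κ * sdist bsrc btgt
            (siteScale (side s L) (side_pos hs hL) (side_dvd hdiv) lvl (zc hs hL hdiv) (cells_cover (Λ := Λ) hs hL hdiv)) p.1 q.1)) *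
          ((siteScale (side s L) (side_pos hs hL) (side_dvd hdiv) lvl (zc hs hL hdiv) (cells_cover (Λ := Λ) hs hL hdiv) p.1 : ℝ) *
            (siteScale (side s L) (side_pos hs hL) (side_dvd hdiv) lvl (zc hs hL hdiv) (cells_cover (Λ := Λ) hs hL hdiv) q.1 : ℝ)) /
          ((1 - (0 : ℝ)) * min (cmin ^ 2 / (4 * d)) (amin / 4) - 2 * d * cmax ^ 2 * κ ^ 2 -
            amax * (Real.exp (2 * d * κ) - 1)) :=
  decay_levelOp_cov (side s L) (side_pos hs hL) (side_dvd hdiv) lvl (zc hs hL hdiv) (cells_disjoint hs hL hdiv)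
    (cells_cover hs hL hdiv) (fun _ => oneM) (fun _ i j => oneM_orth i j) (treeWeight d s L α)
    (treeWeight_nonneg fun l => hamin.trans (hα_lo l)) (meanProfile hs hL hdiv Λ) (meanProfile_supp hs hL hdiv) hamin
    (hamin.trans ((hα_lo true).trans (hα_hi true))) (scale_lo hs hL hdiv hα_lo) (scale_hi hs hL hdiv hα_hi) c hcmin hc_lo hc_hi
    (fun _ _ => oneM) (fun _ _ i i' => oneM_orth i i') (fun _ => 0) (fun _ => le_rfl) (fun k v i hv u => defect_flat _ v i hv u)
    (fun k => by simp) hκ0 hκ1 hμ p q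

/-- RULE G-1 AT A POSITIVE RATE: the covariant END FIRES on the `d = 4` slot family (torus `4⁴`, `s = 1`, `L = 2`, ANY slot `Λ`,
fibre `Unit`, `c ≡ 1`, `α ≡ 1`) with the rate `κ = 10⁻³` — every remaining hypothesis discharged; the smallness number
`min(1∕16, 1∕4) − 8·10⁻⁶ − (e^{0.008} − 1) > 0` is `ShellMeasureDecayRowsLevelOpCellsSlot.mu0_pos_d4` BY NAME (landed there first). [folklore] -/
example (Λ : Finset (Ctr (fun _ : Fin 4 => 4) (2 * 1))) (p q : UT (fun _ : Fin 4 => 4) × Unit) :=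
  decay_levelOp_cov_slot_flatGauge (Λ := Λ) le_rfl (by norm_num) (fun _ => ⟨2, rfl⟩) (α := fun _ => 1) (amin := 1) (amax := 1)
    zero_le_one (fun _ => le_rfl) (fun _ => le_rfl) (fun _ => 1) (cmin := 1) (cmax := 1) one_pos (fun _ => by simp)
    (fun _ => by simp) (κ := 1 / 1000) (by norm_num) (by norm_num) ShellMeasureDecayRowsLevelOpCellsSlot.mu0_pos_d4 p q

end Summit.QuantumFields.BalabanUV.T4Continuum.ShellMeasureDecayRowsLevelOpTwoLevel

end
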